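import Summits.FinalStateConjecture.FinalStateConjecture.Theorems.ZeroEnergyKerrOrBombStationaryLimitReductionRecutCoveringGrowingTransfer
import HarnessLib

/-!
# Route ZeroEnergyKerrOrBomb · crux `StationaryLimitReduction` (stmt-FinalStateConjecture-10021), line
# `symplectic-dual-of-the-bomb` — stub `stub_recutCovering`, wave 3: the junction LOCALISED
# (how clause (ii) of `HasExhaustiveDocCharts'` and `O' ⊆ O` are consumed; the source-free residual)

Helper file (`--supports stmt-FinalStateConjecture-10021`; registered helper `stub_recutCovering_of_core`) of the
lead's wave-3 stub worker for `stub_recutCovering : Sig4.stub_recutCovering` (lead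
prover-line-stmt-FinalStateConjecture-10021-a2-0, 2026-08-16). After `…RecutCoveringWave3.lean` (p124506:
`N = 0`, `(init)` from `(ii)`, reduction to L1 + L2) and `…RecutCoveringGrowingTransfer.lean` (p124807: L1 proved,
`stub_recutCovering_of_junction : RecutJunction → Sig4.stub_recutCovering`), the stub IS the junction
`RecutJunction`: clause (ii) of the recut, source the recut exterior `O' = exteriorOf 𝒟 (recutCharted τ₀')`.
This file strips the source: by `O' ⊆ O ∩ I⁻(docCharted d)` for late `τ₀'` (`exteriorOf_recutCharted_subset`,
p116597, + `docCharted d ⊆ d.charted`) and clause (ii) of `HasExhaustiveDocCharts' d` AT THE SAME chart time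
`τ₁`, every point of `O'` outside the recut certified late region is either in the causal past of the flat
slab at `τ₁` (a recut certified slab piece), or in the causal past of the OLD d.o.c. hole slabs at chart time
`τ₁`, or in the OLD d.o.c.-certified hole tubes after `τ₁` (`recut_ii_of_core_at`). What remains is the
source-free JUNCTION CORE `RecutJunctionCore`: for all late `τ₁`,
`(J⁻(old d.o.c. hole slabs at τ₁) ∪ old d.o.c. hole tubes after τ₁) \ recutCertifiedLate R' τ₁ ⊆ J⁻(recutCertifiedSlab R' τ₁)`
at the transported radii `R'ᵢ τ = Rᵢ(cᵢ τ − s) − W` — a statement about the two chart families of each hole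
near one late chart time (tilt `≤ L`, margin shell flat-charted, near-horizon strip), with no reference to
`O`, `ι X` or `exteriorOf`. Registered: `stub_recutCovering_of_core : RecutJunctionCore → Sig4.stub_recutCovering`.
(Remark for the re-brief: the naive form "old d.o.c. slab at `τ₁` ⊆ J⁻(recut certified slab at `τ₁`)" is
FALSE whenever the tilt is positive somewhere — old slab points of Kerr–Schild time `t* ∈ (τ₁, τ₁ + L]`
near the hole lie in the recut certified LATE region and not in `J⁻` of the Kerr–Schild slab `t* = τ₁`;
only `J⁻(old slab) \ recutCertifiedLate` can be asked for.)

Elementary; no named fact, nothing restated. References: Dafermos–Luk arXiv:1710.01722, Conjecture 1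
(b)–(c); O'Neill 1983, Ch. 14, pp. 402–403.
-/

-- every `Summit.FinalStateConjecture.FinalStateConjecture.…` name repeats the summit = sub-problem segment (D-0017 layout)
set_option linter.dupNamespace false

noncomputable section

open scoped Manifold ContDiff Topology ENNReal
open Set Filter Function Literature.Geometry.Lorentzian

namespace Summit.FinalStateConjecture.FinalStateConjecture.Theorems.SymplecticDualOfTheBomb

open Summit.FinalStateConjecture.FinalStateConjecture.Theorems.OneLockedExplosion

/-! ## §1 Set-theoretic preliminaries -/

section Sets

variable {𝓢 : Spacetime.{0} 4} {O : Set 𝓢.carrier} {k : ℕ}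

/-- The d.o.c.-charted late region lies in the charted late region (drop the d.o.c. parts). [folklore] -/
theorem docCharted_subset_charted (d : StationaryFinalStateDecomposition 𝓢 O k) : docCharted d ⊆ d.charted :=
  union_subset_union le_rfl (iUnion_mono fun _ ↦ image_mono inter_subset_left)

/-- **The old d.o.c. hole slabs at chart time `τ₁`** (hole part of `docCertifiedSlab d R τ₁`). [folklore] -/
def docHoleSlabs (d : StationaryFinalStateDecomposition 𝓢 O k) (R : Fin d.N → ℝ → ℝ) (τ₁ : ℝ) :
    Set 𝓢.carrier :=
  ⋃ i, d.toOver.chart i '' ((d.background i).truncTimeSlab (R i τ₁) τ₁ ∩ docPart d i)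

/-- **The old d.o.c.-certified hole tubes after chart time `τ₁`** (hole part of `docCertifiedLate d R τ₁`).
[folklore] -/
def docHoleTubes (d : StationaryFinalStateDecomposition 𝓢 O k) (R : Fin d.N → ℝ → ℝ) (τ₁ : ℝ) :
    Set 𝓢.carrier :=
  ⋃ i, d.toOver.chart i '' ({x | τ₁ < (d.background i).time x.1 ∧
    (d.background i).radius x.1 ≤ R i ((d.background i).time x.1)} ∩ docPart d i)

/-- `docCertifiedSlab = flat slab ∪ docHoleSlabs` (definitional). [folklore] -/
theorem docCertifiedSlab_eq (d : StationaryFinalStateDecomposition 𝓢 O k) (R : Fin d.N → ℝ → ℝ) (τ₁ : ℝ) :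
    docCertifiedSlab d R τ₁ =
      d.toOver.flatChart '' (Minkowski.backgroundOn d.toOver.flatDomain).timeSlab τ₁ ∪ docHoleSlabs d R τ₁ :=
  rfl

/-- `docCertifiedLate = flat late region ∪ docHoleTubes` (definitional). [folklore] -/
theorem docCertifiedLate_eq (d : StationaryFinalStateDecomposition 𝓢 O k) (R : Fin d.N → ℝ → ℝ) (τ₁ : ℝ) :
    docCertifiedLate d R τ₁ =
      d.toOver.flatChart '' (Minkowski.backgroundOn d.toOver.flatDomain).lateRegion τ₁ ∪ docHoleTubes d R τ₁ :=
  rfl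

end Sets

section Causal

variable {E : Type*} [NormedAddCommGroup E] [NormedSpace ℝ E] {H : Type*} [TopologicalSpace H]
  {I : ModelWithCorners ℝ E H} {n : ℕ∞ω} {M : Type*} [TopologicalSpace M] [ChartedSpace H M]
  [IsManifold I ∞ M] {g : LorentzianMetric I n M} {τ : TimeOrientation g}

/-- `J⁻(S ∪ T) ⊆ J⁻(S) ∪ J⁻(T)` (`J⁻` is computed pointwise). O'Neill 1983, Ch. 14, p. 403. [folklore] -/
theorem causalPast_union_subset (S T : Set M) :
    g.causalPast τ (S ∪ T) ⊆ g.causalPast τ S ∪ g.causalPast τ T := by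
  rintro q (hq | ⟨p, hp, h⟩)
  · exact hq.elim (fun h ↦ Or.inl (Or.inl h)) fun h ↦ Or.inr (Or.inl h)
  · exact hp.elim (fun hp ↦ Or.inl (Or.inr ⟨p, hp, h⟩)) fun hp ↦ Or.inr (Or.inr ⟨p, hp, h⟩)

end Causal

/-! ## §2 Clause (ii) of the recut from the core inclusion, at one chart time -/

section OneTime

variable {X : Type} [TopologicalSpace X] [ChartedSpace E3 X] [IsManifold (𝓡 3) ∞ X]
  [ConnectedSpace X] {D : InitialDataSet (𝓡 3) X}

/-- **Clause (ii) of the recut at `τ₁` from the core inclusion at `τ₁`.** If the recut exterior `O'` lies in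
`O ∩ I⁻(docCharted d)`, clause (ii) of `HasExhaustiveDocCharts' d` holds at `τ₁` for the radii `R`, and the CORE
inclusion `(J⁻(docHoleSlabs R τ₁) ∪ docHoleTubes R τ₁) \ recutCertifiedLate R' τ₁ ⊆ J⁻(recutCertifiedSlab R' τ₁)`
holds, then `O' \ recutCertifiedLate R' τ₁ ⊆ J⁻(recutCertifiedSlab R' τ₁)`: a point of `O'` outside the recut
certified late region is (old (ii)) in the old flat late region — excluded —, in an old d.o.c. hole tube, in
`J⁻` of the flat slab at `τ₁` — a recut certified slab piece —, or in `J⁻` of the old d.o.c. hole slabs. [folklore] -/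
theorem recut_ii_of_core_at (𝒟 : CauchyDevelopment D) {O : Set 𝒟.carrier} {k : ℕ}
    (d : StationaryFinalStateDecomposition 𝒟.toSpacetime O k) (M a : Fin d.N → ℝ) (Θ : Fin d.N → E4 → E4)
    (R R' : Fin d.N → ℝ → ℝ) {O' : Set 𝒟.carrier} (τ₁ : ℝ)
    (hO' : O' ⊆ O ∩ 𝒟.metric.chronologicalPast 𝒟.timeOrientation (docCharted d))
    (hii : (O ∩ 𝒟.metric.chronologicalPast 𝒟.timeOrientation (docCharted d)) \ docCertifiedLate d R τ₁ ⊆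
      𝒟.metric.causalPast 𝒟.timeOrientation (docCertifiedSlab d R τ₁))
    (hcore : (𝒟.metric.causalPast 𝒟.timeOrientation (docHoleSlabs d R τ₁) ∪ docHoleTubes d R τ₁) \
        recutCertifiedLate d M a Θ R' τ₁ ⊆
      𝒟.metric.causalPast 𝒟.timeOrientation (recutCertifiedSlab d M a Θ R' τ₁)) :
    O' \ recutCertifiedLate d M a Θ R' τ₁ ⊆
      𝒟.metric.causalPast 𝒟.timeOrientation (recutCertifiedSlab d M a Θ R' τ₁) := by
  intro p hp
  by_cases hlate : p ∈ docCertifiedLate d R τ₁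
  · rw [docCertifiedLate_eq] at hlate
    rcases hlate with hflat | htube
    · exact (hp.2 (Or.inl hflat)).elim
    · exact hcore ⟨Or.inr htube, hp.2⟩
  · have h := hii ⟨hO' hp.1, hlate⟩
    rw [docCertifiedSlab_eq] at h
    rcases causalPast_union_subset _ _ h with hflat | hslab
    · exact LorentzianMetric.causalFuture_mono subset_union_left hflat
    · exact hcore ⟨Or.inl hslab, hp.2⟩

end OneTime

/-! ## §3 The source-free junction core and the reduction -/

/-- **L2-core · the junction, localised** (ABSENT from tree and print): under the hypotheses of
`Sig4.stub_recutCovering` with the radii `R` of `HasExhaustiveDocCharts' d` exposed, for all `s, W` beyond a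
threshold there is a chart time `τJ` such that for every `τ₁ > τJ`, at the transported radii
`R'ᵢ τ = Rᵢ (cᵢ τ − s) − W`:
`(J⁻(docHoleSlabs d R τ₁) ∪ docHoleTubes d R τ₁) \ recutCertifiedLate R' τ₁ ⊆ J⁻(recutCertifiedSlab R' τ₁)` —
points below the OLD d.o.c. hole slabs of chart time `τ₁`, or in the old certified tubes after `τ₁`, which are
neither flat-late nor recut-certified, are causally before the flat slab at `τ₁` or a recut Kerr–Schild
truncated slab `{t*ᵢ = τ₁, rᵢ ≤ R'ᵢ τ₁}`. Ingredients of a proof (none formal today): the late metric is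
`C⁰`-close to Kerr / `η` on the certified regions, so Kerr–Schild time and flat time increase along causal
curves and the model time flows are causal away from the horizon strip; the shell between `R'` and the old
radius is flat-charted (margin (iii)); the strip `r₊ < r < r₊ + δ` needs horizon normalisation.
(ref: DafermosLuk2017, Conjecture 1 (b)–(c)) -/
def RecutJunctionCore : Prop :=
  ∀ (X : Type) [TopologicalSpace X] [ChartedSpace E3 X] [IsManifold (𝓡 3) ∞ X]
    [T2Space X] [SecondCountableTopology X] [ConnectedSpace X] (D : InitialDataSet (𝓡 3) X)
    (𝒟 : VacuumCauchyDevelopment D) (O : Set 𝒟.carrier)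
    (d : StationaryFinalStateDecomposition 𝒟.toSpacetime O 2)
    (M a c r₀ : Fin d.N → ℝ) (Θ : Fin d.N → E4 → E4) (R : Fin d.N → ℝ → ℝ),
    O = Summit.FinalStateConjecture.exteriorOf 𝒟.toCauchyDevelopment d.charted →
    (∀ i, Tendsto (fun τ ↦ 𝒟.toSpacetime.truncDeviationCk (d.background i) (d.toOver.chart i) 2 (R i τ) τ)
      atTop (𝓝 0)) →
    (∀ i, Monotone (R i)) → (∀ i, Tendsto (R i) atTop atTop) →
    (∀ i, ∀ W s₀ : ℝ, ∀ᶠ σ in atTop,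
      d.toOver.chart i '' ({x | (d.background i).time x.1 = σ ∧
        R i (σ - s₀) - W ≤ (d.background i).radius x.1} ∩ docPart d i) ⊆ d.toOver.radiationZone) →
    (∀ τ₁ : ℝ, d.toOver.τ₀ < τ₁ →
      (O ∩ 𝒟.metric.chronologicalPast 𝒟.timeOrientation (docCharted d)) \ docCertifiedLate d R τ₁ ⊆
        𝒟.metric.causalPast 𝒟.timeOrientation (docCertifiedSlab d R τ₁)) →
    IsHorizonNormalised d →
    (∀ i, (d.hole i).horizon ⊆ Set.range (d.adapted i).toFun ∧
      ChartIsAsymptoticallyCartesian (d.adapted i) ∧ InTelescope (d.hole i)) →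
    (∀ i, IsKerrChartedWith (d.hole i) (d.adapted i) (M i) (a i) (c i) (r₀ i) (Θ i)) →
    ∃ s₁ : ℝ, ∀ s W : ℝ, s₁ ≤ s → s₁ ≤ W → ∃ τJ : ℝ, ∀ τ₁ : ℝ, τJ < τ₁ →
      (𝒟.metric.causalPast 𝒟.timeOrientation (docHoleSlabs d R τ₁) ∪ docHoleTubes d R τ₁) \
          recutCertifiedLate d M a Θ (fun i τ ↦ R i (c i * τ - s) - W) τ₁ ⊆
        𝒟.metric.causalPast 𝒟.timeOrientation
          (recutCertifiedSlab d M a Θ (fun i τ ↦ R i (c i * τ - s) - W) τ₁)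

/-- **The junction follows from its core.** For `s, W` beyond the core's threshold take the recut time
`τ₀' := max (max τJ τ₀) (τ₀ + ∑ᵢ |(τ₀ + Lᵢ)/cᵢ − τ₀|)` (`Lᵢ` the tilt bounds of `kerrChartedWith_tilt_bound`):
then `O' ⊆ exteriorOf 𝒟 (docCharted d) ⊆ O ∩ I⁻(docCharted d)` (`exteriorOf_recutCharted_subset`,
`docCharted_subset_charted`), old (ii) holds at every `τ₁ > τ₀' ≥ τ₀`, and `recut_ii_of_core_at` applies.
[folklore] -/
theorem recutJunction_of_core : RecutJunctionCore → RecutJunction := by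
  intro hcore X _ _ _ _ _ _ D 𝒟 O d M a c r₀ Θ R hO hRi hRmono hRtop hRiii hRii hnorm hreg hW
  obtain ⟨s₁, hs₁⟩ := hcore X D 𝒟 O d M a c r₀ Θ R hO hRi hRmono hRtop hRiii hRii hnorm hreg hW
  refine ⟨s₁, fun s W hs hWs ↦ ?_⟩
  obtain ⟨τJ, hJ⟩ := hs₁ s W hs hWs
  choose L hL using fun i ↦ kerrChartedWith_tilt_bound _ _ _ _ _ _ _ (hW i)
  set τ₀' : ℝ := max (max τJ d.toOver.τ₀) (d.toOver.τ₀ + ∑ j, |(d.toOver.τ₀ + L j) / c j - d.toOver.τ₀|)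
    with hτ₀'
  have hO'E : Summit.FinalStateConjecture.exteriorOf 𝒟.toCauchyDevelopment (recutCharted d M a Θ τ₀') ⊆
      O ∩ 𝒟.metric.chronologicalPast 𝒟.timeOrientation (docCharted d) := fun p hp ↦ by
    have h := exteriorOf_recutCharted_subset 𝒟.toCauchyDevelopment d hW hL (le_max_right _ _) hp
    refine ⟨?_, h.2⟩
    rw [hO]
    exact exteriorOf_mono _ (docCharted_subset_charted d) h
  refine ⟨τ₀', (le_max_right _ _).trans (le_max_left _ _), fun τ₁ hτ₁ ↦ ?_⟩
  have hτJ : τJ < τ₁ := ((le_max_left _ _).trans (le_max_left _ _)).trans_lt hτ₁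
  have hτ₀ : d.toOver.τ₀ < τ₁ := ((le_max_right _ _).trans (le_max_left _ _)).trans_lt hτ₁
  exact recut_ii_of_core_at 𝒟.toCauchyDevelopment d M a Θ R _ τ₁ hO'E (hRii τ₁ hτ₀) (hJ τ₁ hτJ)

/-- **Registered helper `stub_recutCovering_of_core`: the registered stub `stub_recutCovering`
(`Sig4.stub_recutCovering`) follows from the source-free junction core alone** (`recutJunction_of_core`, then
`stub_recutCovering_of_junction`, p124807). [folklore] -/
theorem stub_recutCovering_of_core : RecutJunctionCore → Sig4.stub_recutCovering :=
  fun h ↦ stub_recutCovering_of_junction (recutJunction_of_core h)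

end Summit.FinalStateConjecture.FinalStateConjecture.Theorems.SymplecticDualOfTheBomb

end
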